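import Literature.MathematicalPhysics.QuantumLattice.HubbardTPPClusterFloorLocal
import Literature.MathematicalPhysics.QuantumLattice.HubbardTPPAxialMeanEnergyBox
import HarnessLib

/-!
# The infinite-volume Anderson cluster floor for object M: the `t–t'–t''` fixed-filling energy density
# from kernel sector floors of the open `3 × 2` / `2 × 3` clusters — exact in `t''`

Topic `MathematicalPhysics/QuantumLattice`, family `hubbard`. Object M of the material-oracle seam is
`e^M(t,t',t'',U; ρ) = (hubbardTT'T''FermionInteraction t t' t'' U).tiGroundEnergyDensityAt 2 ρ`, the infimum of
the mean energy over translation-invariant states of density `ρ`. For a translation-invariant `ω` every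
bond energy is site independent (`InfVolFermionStateHubbardMeanEnergyBox`, `…TTPrimeMeanEnergyBox`,
`HubbardTPPAxialMeanEnergyBox`), so the expectations of the free-boundary box Hamiltonians of the two
rectangles `[0,3)×[0,2)` and `[0,2)×[0,3)` of the RESCALED interaction `Ψ' = Ψ(t/7, t'/4, t''/2, U/12)` add up
to the mean energy of `Ψ(t,t',t'',U)`: a nearest-neighbour bond class has `4 + 3 = 7` translates inside the two
rectangles, a diagonal class `2 + 2 = 4`, a third-neighbour class `2 + 0` resp. `0 + 2`, a site `6 + 6 = 12`
(§2, counts by `decide`). With the local cluster floor of `HubbardTPPClusterFloorLocal` (sector floors of the open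
cluster `hubbardOpenBoxTT'T''` ⇒ a floor on `Re ω(H^{Ψ'}_R) + μ Re ω(N_R)` for every state) and `Re ω(N_R) = 6ρ`
this gives **`m + m' − 6(μ + μ')ρ ≤ e^M(t,t',t'',U; ρ)`** from kernel floors of `hubbardOpenBoxTT'T'' 3 2 …` and
`… 2 3 …` (§3) — the `t''`-EXACT twin of the torus law `energyDensityTT'_ge_of_boxFloors_2x3`, proved directly in
infinite volume. Everything is proved; no definition, no named fact, nothing numerical.

## References

* P. W. Anderson, Phys. Rev. 83 (1951) 1260, eq. (2). [cite: Anderson1951, eq. (2)]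
* D. Ruelle, *Statistical Mechanics: Rigorous Results* (1969), §3.4. [cite: Ruelle1969, §3.4]
* O. Bratteli, D. W. Robinson, *OAQSM 2* (1997), §6.2.4 (Prop. 6.2.38 ff.). [cite: BratteliRobinsonII1997, §6.2.4 (Prop. 6.2.38 ff.)]
* E. Pavarini et al., Phys. Rev. Lett. 87 (2001) 047003, eq. (1). [cite: PavariniEtAl2001, eq. (1)]
-/

noncomputable section

namespace Literature.MathematicalPhysics.QuantumLattice

open Matrix Finset HubbardWave0 Literature.Probability.LatticeModels ThermodynamicLimit
open scoped ComplexOrder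

namespace InfVolFermionState

variable {ω : InfVolFermionState 2}

/-! ### §1 Term expectations scale with the couplings -/

/-- On-site term: `ω(Φ_{t,U}{0}) = U · ω(Φ_{0,1}{0})`. [cite: PavariniEtAl2001, eq. (1)] -/
theorem expect_hubbard_singleton_eq_mul (ω : InfVolFermionState 2) (t U : ℝ) :
    ω.expect {0} ((hubbardFermionInteraction 2 t U).Φ {0}) =
      (U : ℂ) * ω.expect {0} ((hubbardFermionInteraction 2 0 1).Φ {0}) := by
  simp only [hubbardFermionInteraction_apply_singleton, map_smul, smul_eq_mul, Complex.ofReal_one, one_mul]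

/-- Nearest-neighbour bond term: `ω(Φ_{t,U}{0, e_i}) = t · ω(Φ_{1,0}{0, e_i})`. [cite: PavariniEtAl2001, eq. (1)] -/
theorem expect_hubbard_pair_eq_mul (ω : InfVolFermionState 2) (t U : ℝ) (i : Fin 2) :
    ω.expect {0, 0 + unitVec i} ((hubbardFermionInteraction 2 t U).Φ {0, 0 + unitVec i}) =
      (t : ℂ) * ω.expect {0, 0 + unitVec i} ((hubbardFermionInteraction 2 1 0).Φ {0, 0 + unitVec i}) := by
  simp only [hubbardFermionInteraction_apply_pair, map_smul, smul_eq_mul, Complex.ofReal_one]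
  ring

/-- Diagonal bond term: `ω(Φ^{t'}{0, j_s}) = t' · ω(Φ^{1}{0, j_s})`. [cite: PavariniEtAl2001, eq. (1)] -/
theorem expect_diagHopping_pair_eq_mul (ω : InfVolFermionState 2) (t' : ℝ) (s : Fin 2) :
    ω.expect {0, 0 + diagVec s} ((diagHoppingFermionInteraction t').Φ {0, 0 + diagVec s}) =
      (t' : ℂ) * ω.expect {0, 0 + diagVec s} ((diagHoppingFermionInteraction 1).Φ {0, 0 + diagVec s}) := by
  simp only [diagHoppingFermionInteraction_apply_pair, map_smul, smul_eq_mul, Complex.ofReal_one]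
  ring

/-- Third-neighbour bond term: `ω(Φ''^{t''}{0, 2e_i}) = t'' · ω(Φ''^{1}{0, 2e_i})`. [cite: PavariniEtAl2001, eq. (1)] -/
theorem expect_axial2_pair_eq_mul (ω : InfVolFermionState 2) (t'' : ℝ) (i : Fin 2) :
    ω.expect {0, 0 + axial2Vec i} ((axialRange2HoppingFermionInteraction 2 t'').Φ {0, 0 + axial2Vec i}) =
      (t'' : ℂ) * ω.expect {0, 0 + axial2Vec i} ((axialRange2HoppingFermionInteraction 2 1).Φ {0, 0 + axial2Vec i}) := by
  simp only [axialRange2HoppingFermionInteraction_apply_pair, map_smul, smul_eq_mul, Complex.ofReal_one]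
  ring

/-! ### §2 Box Hamiltonians and the mean energy of the `t–t'–t''` model through the unit bond densities -/

/-- **The `t–t'–t''` box Hamiltonian of a translation-invariant state through the unit term densities**: for every
finite `Λ ⊆ ℤ²`, `ω(H^{Ψ(a,b,c,u)}_Λ) = |Λ|·u·D + Σ_i #{x : x+e_i ∈ Λ}·a·K_i + Σ_s #{x : x+j_s ∈ Λ}·b·K'_s
+ c·Σ_i #{x : x+2e_i ∈ Λ}·K''_i` with the unit-coupling term expectations `D, K_i, K'_s, K''_i`.
[cite: BratteliRobinsonII1997, §6.2.4 (Prop. 6.2.38 ff.)] -/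
theorem IsTranslationInvariant.expect_localHamiltonian_tpp (hω : ω.IsTranslationInvariant) (a b c u : ℝ)
    (Λ : Finset (Site 2)) :
    ω.expect Λ ((hubbardTT'T''FermionInteraction a b c u).localHamiltonian Λ) =
      (Λ.card : ℂ) * ((u : ℂ) * ω.expect {0} ((hubbardFermionInteraction 2 0 1).Φ {0})) +
        ∑ i : Fin 2, ((Λ.filter fun x => x + unitVec i ∈ Λ).card : ℂ) *
          ((a : ℂ) * ω.expect {0, 0 + unitVec i} ((hubbardFermionInteraction 2 1 0).Φ {0, 0 + unitVec i})) +
        ∑ s : Fin 2, ((Λ.filter fun x => x + diagVec s ∈ Λ).card : ℂ) *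
          ((b : ℂ) * ω.expect {0, 0 + diagVec s} ((diagHoppingFermionInteraction 1).Φ {0, 0 + diagVec s})) +
        (c : ℂ) * ∑ i : Fin 2, ((Λ.filter fun x => x + axial2Vec i ∈ Λ).card : ℂ) *
          ω.expect {0, 0 + axial2Vec i} ((axialRange2HoppingFermionInteraction 2 1).Φ {0, 0 + axial2Vec i}) := by
  rw [hubbardTT'T''FermionInteraction, FermionInteraction.localHamiltonian_pencil, map_add, map_smul,
    hubbardTTPrimeFermionInteraction_localHamiltonian, map_add, hω.expect_hubbard_localHamiltonian a u Λ,
    hω.expect_diagHopping_localHamiltonian b Λ, hω.expect_axial2_localHamiltonian 1 Λ, smul_eq_mul,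
    ω.expect_hubbard_singleton_eq_mul a u]
  simp only [ω.expect_hubbard_pair_eq_mul a u, ω.expect_diagHopping_pair_eq_mul b]

/-- **The `t–t'–t''` mean energy (range parameter `2`) of a translation-invariant state through the unit term
densities**: `e^{Ψ(t,t',t'',U)}(ω) = Re(U·D + Σ_i t·K_i) + Σ_s Re(t'·K'_s) + t''·Σ_i Re K''_i`.
[cite: BratteliKishimotoRobinson1978, §3 (mean energy functional)] -/
theorem IsTranslationInvariant.meanEnergy_tpp_two (hω : ω.IsTranslationInvariant) (t t' t'' U : ℝ) :
    ω.meanEnergy (hubbardTT'T''FermionInteraction t t' t'' U) 2 =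
      ((U : ℂ) * ω.expect {0} ((hubbardFermionInteraction 2 0 1).Φ {0}) +
          ∑ i : Fin 2, (t : ℂ) * ω.expect {0, 0 + unitVec i} ((hubbardFermionInteraction 2 1 0).Φ {0, 0 + unitVec i})).re +
        ∑ s : Fin 2, ((t' : ℂ) * ω.expect {0, 0 + diagVec s} ((diagHoppingFermionInteraction 1).Φ {0, 0 + diagVec s})).re +
        t'' * ∑ i : Fin 2, (ω.expect {0, 0 + axial2Vec i}
          ((axialRange2HoppingFermionInteraction 2 1).Φ {0, 0 + axial2Vec i})).re := by
  have hTT : ω.meanEnergy (hubbardTTPrimeFermionInteraction t t' U) 2 = ω.meanEnergy (hubbardTTPrimeFermionInteraction t t' U) 1 :=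
    meanEnergy_eq_of_le ω _ (by norm_num) fun X h0 hX => hubbardTTPrimeFermionInteraction_apply_eq_zero_of_not_subset t t' U h0 hX
  rw [hubbardTT'T''FermionInteraction, ω.meanEnergy_pencil, hTT, hω.meanEnergy_hubbardTTPrime_eq t' t U,
    InfVolFermionState.hubbardEnergyDensity, InfVolFermionState.meanEnergy, hω.expect_hubbard_meanEnergyObs t U,
    InfVolFermionState.meanEnergy, hω.expect_axial2_meanEnergyObs 1, Complex.re_sum, ω.expect_hubbard_singleton_eq_mul t U]
  simp only [ω.expect_hubbard_pair_eq_mul t U, ω.expect_diagHopping_pair_eq_mul t']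

/-! ### Counts of bond translates inside the two rectangles (`decide`) -/

/-- Translate count inside the rectangle (kernel `decide`). [folklore] -/
private theorem card_rect32 : (halfOpenRect ![2, 1]).card = 6 := by decide
/-- Translate count inside the rectangle (kernel `decide`). [folklore] -/
private theorem cnt32_e0 : ((halfOpenRect ![2, 1]).filter (fun x => x + unitVec 0 ∈ halfOpenRect ![2, 1])).card = 4 := by decide
/-- Translate count inside the rectangle (kernel `decide`). [folklore] -/
private theorem cnt32_e1 : ((halfOpenRect ![2, 1]).filter (fun x => x + unitVec 1 ∈ halfOpenRect ![2, 1])).card = 3 := by decide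
/-- Translate count inside the rectangle (kernel `decide`). [folklore] -/
private theorem cnt32_d0 : ((halfOpenRect ![2, 1]).filter (fun x => x + diagVec 0 ∈ halfOpenRect ![2, 1])).card = 2 := by decide
/-- Translate count inside the rectangle (kernel `decide`). [folklore] -/
private theorem cnt32_d1 : ((halfOpenRect ![2, 1]).filter (fun x => x + diagVec 1 ∈ halfOpenRect ![2, 1])).card = 2 := by decide
/-- Translate count inside the rectangle (kernel `decide`). [folklore] -/
private theorem cnt32_a0 : ((halfOpenRect ![2, 1]).filter (fun x => x + axial2Vec 0 ∈ halfOpenRect ![2, 1])).card = 2 := by decide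
/-- Translate count inside the rectangle (kernel `decide`). [folklore] -/
private theorem cnt32_a1 : ((halfOpenRect ![2, 1]).filter (fun x => x + axial2Vec 1 ∈ halfOpenRect ![2, 1])).card = 0 := by decide
/-- Translate count inside the rectangle (kernel `decide`). [folklore] -/
private theorem card_rect23 : (halfOpenRect ![1, 2]).card = 6 := by decide
/-- Translate count inside the rectangle (kernel `decide`). [folklore] -/
private theorem cnt23_e0 : ((halfOpenRect ![1, 2]).filter (fun x => x + unitVec 0 ∈ halfOpenRect ![1, 2])).card = 3 := by decide
/-- Translate count inside the rectangle (kernel `decide`). [folklore] -/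
private theorem cnt23_e1 : ((halfOpenRect ![1, 2]).filter (fun x => x + unitVec 1 ∈ halfOpenRect ![1, 2])).card = 4 := by decide
/-- Translate count inside the rectangle (kernel `decide`). [folklore] -/
private theorem cnt23_d0 : ((halfOpenRect ![1, 2]).filter (fun x => x + diagVec 0 ∈ halfOpenRect ![1, 2])).card = 2 := by decide
/-- Translate count inside the rectangle (kernel `decide`). [folklore] -/
private theorem cnt23_d1 : ((halfOpenRect ![1, 2]).filter (fun x => x + diagVec 1 ∈ halfOpenRect ![1, 2])).card = 2 := by decide
/-- Translate count inside the rectangle (kernel `decide`). [folklore] -/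
private theorem cnt23_a0 : ((halfOpenRect ![1, 2]).filter (fun x => x + axial2Vec 0 ∈ halfOpenRect ![1, 2])).card = 0 := by decide
/-- Translate count inside the rectangle (kernel `decide`). [folklore] -/
private theorem cnt23_a1 : ((halfOpenRect ![1, 2]).filter (fun x => x + axial2Vec 1 ∈ halfOpenRect ![1, 2])).card = 2 := by decide

/-- **THE TRANSLATION-CLASS IDENTITY**: for a translation-invariant state `ω` and the rescaled interaction
`Ψ' = Ψ(t/7, t'/4, t''/2, U/12)`, the expectations of the box Hamiltonians of the rectangles `[0,3)×[0,2)` and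
`[0,2)×[0,3)` add up to the mean energy of `Ψ(t,t',t'',U)`: `Re ω(H^{Ψ'}_{[0,3)×[0,2)}) + Re ω(H^{Ψ'}_{[0,2)×[0,3)}) = e(ω)`.
[cite: BratteliRobinsonII1997, §6.2.4 (Prop. 6.2.38 ff.)] -/
theorem IsTranslationInvariant.re_expect_localHamiltonian_rects_eq_meanEnergy (hω : ω.IsTranslationInvariant)
    (t t' t'' U : ℝ) :
    (ω.expect (halfOpenRect ![2, 1]) ((hubbardTT'T''FermionInteraction (t / 7) (t' / 4) (t'' / 2) (U / 12)).localHamiltonian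
        (halfOpenRect ![2, 1]))).re +
      (ω.expect (halfOpenRect ![1, 2]) ((hubbardTT'T''FermionInteraction (t / 7) (t' / 4) (t'' / 2) (U / 12)).localHamiltonian
        (halfOpenRect ![1, 2]))).re =
      ω.meanEnergy (hubbardTT'T''FermionInteraction t t' t'' U) 2 := by
  rw [hω.expect_localHamiltonian_tpp, hω.expect_localHamiltonian_tpp, hω.meanEnergy_tpp_two]
  simp only [Fin.sum_univ_two, card_rect32, cnt32_e0, cnt32_e1, cnt32_d0, cnt32_d1, cnt32_a0, cnt32_a1,
    card_rect23, cnt23_e0, cnt23_e1, cnt23_d0, cnt23_d1, cnt23_a0, cnt23_a1]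
  -- name the unit term densities and split into real and imaginary parts
  set D := ω.expect {0} ((hubbardFermionInteraction 2 0 1).Φ {0}) with hD
  set K0 := ω.expect {0, 0 + unitVec 0} ((hubbardFermionInteraction 2 1 0).Φ {0, 0 + unitVec 0}) with hK0
  set K1 := ω.expect {0, 0 + unitVec 1} ((hubbardFermionInteraction 2 1 0).Φ {0, 0 + unitVec 1}) with hK1
  set P0 := ω.expect {0, 0 + diagVec 0} ((diagHoppingFermionInteraction 1).Φ {0, 0 + diagVec 0}) with hP0
  set P1 := ω.expect {0, 0 + diagVec 1} ((diagHoppingFermionInteraction 1).Φ {0, 0 + diagVec 1}) with hP1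
  set A0 := ω.expect {0, 0 + axial2Vec 0} ((axialRange2HoppingFermionInteraction 2 1).Φ {0, 0 + axial2Vec 0}) with hA0
  set A1 := ω.expect {0, 0 + axial2Vec 1} ((axialRange2HoppingFermionInteraction 2 1).Φ {0, 0 + axial2Vec 1}) with hA1
  simp only [Complex.add_re, Complex.mul_re, Complex.ofReal_re, Complex.ofReal_im, Complex.natCast_re, Complex.natCast_im,
    zero_mul, sub_zero]
  push_cast
  ring

/-! ### §3 The law: kernel sector floors of the two open clusters ⇒ a floor on object M, exact in `t''` -/

/-- **THE INFINITE-VOLUME ANDERSON CLUSTER FLOOR FOR OBJECT M.** Kernel sector floors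
`σ_k ≤ E₀(hubbardOpenBoxTT'T'' 3 2 (t/7) (t'/4) (t''/2) (U/12), k)` and `σ'_k ≤ E₀(hubbardOpenBoxTT'T'' 2 3 …, k)`
(`k ≤ 12`) with supporting lines `m ≤ σ_k + μk`, `m' ≤ σ'_k + μ'k` give, at every density `0 < ρ < 2`:
`m + m' − 6(μ + μ')ρ ≤ e^M(t,t',t'',U; ρ)` (range parameter `2`) — every third-neighbour bond of `ℤ²` is read
EXACTLY by the clusters (no kinematic `t''` allowance). [cite: Anderson1951, eq. (2)] [cite: Ruelle1969, §3.4] -/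
theorem tiGroundEnergyDensityAt_tpp_ge_of_boxFloors_2x3 {σ σ' : ℕ → ℝ} {t t' t'' U : ℝ}
    (hF : ∀ k ≤ 12, σ k ≤ groundEnergy (hubbardOpenBoxTT'T'' 3 2 (t / 7) (t' / 4) (t'' / 2) (U / 12)) k)
    (hF' : ∀ k ≤ 12, σ' k ≤ groundEnergy (hubbardOpenBoxTT'T'' 2 3 (t / 7) (t' / 4) (t'' / 2) (U / 12)) k)
    (μ m μ' m' : ℝ) (hm : ∀ k ≤ 12, m ≤ σ k + μ * k) (hm' : ∀ k ≤ 12, m' ≤ σ' k + μ' * k)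
    {ρ : ℝ} (hρ0 : 0 < ρ) (hρ2 : ρ < 2) :
    m + m' - 6 * (μ + μ') * ρ ≤ (hubbardTT'T''FermionInteraction t t' t'' U).tiGroundEnergyDensityAt 2 ρ := by
  refine (hubbardTT'T''FermionInteraction t t' t'' U).le_tiGroundEnergyDensityAt 2
    (exists_isTranslationInvariant_density_eq hρ0 hρ2) fun ω hω hρ => ?_
  have h1 := ω.le_re_expect_localHamiltonian_tpp_of_sectorFloors ![2, 1] (t / 7) (t' / 4) (t'' / 2) (U / 12) (σ := σ)
    (fun k hk => hF k (by simpa using hk)) μ m (fun k hk => hm k (by simpa using hk))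
  have h2 := ω.le_re_expect_localHamiltonian_tpp_of_sectorFloors ![1, 2] (t / 7) (t' / 4) (t'' / 2) (U / 12) (σ := σ')
    (fun k hk => hF' k (by simpa using hk)) μ' m' (fun k hk => hm' k (by simpa using hk))
  have hN1 : (ω.expect (halfOpenRect ![2, 1]) (totalNumber : FermionOp (halfOpenRect ![2, 1]))).re = 6 * ρ := by
    rw [hω.re_expect_totalNumber_eq_card_mul_density, card_rect32, hρ]; norm_num
  have hN2 : (ω.expect (halfOpenRect ![1, 2]) (totalNumber : FermionOp (halfOpenRect ![1, 2]))).re = 6 * ρ := by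
    rw [hω.re_expect_totalNumber_eq_card_mul_density, card_rect23, hρ]; norm_num
  rw [hN1] at h1
  rw [hN2] at h2
  have hid := hω.re_expect_localHamiltonian_rects_eq_meanEnergy t t' t'' U
  linarith

end InfVolFermionState

end Literature.MathematicalPhysics.QuantumLattice

end
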